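import Literature.AlgebraicGeometry.Motives.CompleteIntersectionLinesThroughPoints
import Literature.RingTheory.MvPolynomial.LineChainConnectivity

/-!
# Complete intersections of degree `Σ dₐ ≤ N - 1` are chain connected by lines (Kollár V.4.8.1, on schemes)

For a closed `k`-immersion `i : X ↪ ℙᴺ_k` (`k` algebraically closed, `X` locally of finite type)
with image `V₊(F₁, …, F_c)`, `Fₐ` forms of degrees `dₐ ≥ 1` with `Σₐ dₐ + 1 ≤ N`, **any two closed
points `x, y` of `X` are joined by a connected chain of lines of `X`**: there are line points
`ℓ₀, …, ℓ_m` of `X` (`IsLinePoint N i ℓ_j`, `Motives/LinesGenerateChowOne`: `dim closure {ℓ_j} = 1`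
and `i(closure {ℓ_j})` is a line `V₊(L₁, …, L_{N-1})` of `ℙᴺ`) with `x ∈ closure {ℓ₀}`,
`y ∈ closure {ℓ_m}` and `closure {ℓ_j} ∩ closure {ℓ_{j+1}} ≠ ∅` (`exists_lineChain_of_isClosed`).
This is "`X` is rationally chain connected by chains of lines" (Kollár, *Rational Curves on
Algebraic Varieties*, V.4.8.1; the first sentence of the proof of Tian–Zong, Compositio Math. 150
(2014), Thm. 6.1), for every — possibly singular or reducible — `V₊(F)` in that range.

Assembly: the closed points underlie `k`-points with homogeneous coordinates `p, q`
(`EsnaultLevineViehweg.exists_algPoints_pt_eq`, `ProjectiveSpace.exists_eq_pointOfVec`); the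
coordinate theorem `Literature.RingTheory.MvPolynomial.exists_chain_of_sum_deg_le`
(`RingTheory/MvPolynomial/LineChainConnectivity`, from the multihomogeneous Bézout existence
theorem) gives vectors `p = v₀, v₁, …, v_{r+1} = q` with every `Fₐ` vanishing on consecutive
spans; a degenerate link (`v_j ∥ v_{j+1}`) is replaced by any line of `X` through `[v_j]`
(`EsnaultLevineViehweg.exists_linearIndependent_lineRestrict_eq_zero`, lines through every point
when `Σ dₐ ≤ N - 1`); each span is cut out by `N - 1` coordinate forms containing the `Fₐ` in their
ideal (`EsnaultLevineViehweg.exists_linearForms_forall_mem_ideal_span`), hence is the image of the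
closure of a line point (`exists_isLinePoint_of_zeroLocus_subset`, `Motives/LinesInProjectiveSpace`),
and consecutive lines share the point of `X` over `[v_{j+1}]`. Everything is proved; no
definitions, no named facts.

## References

* J. Kollár, *Rational Curves on Algebraic Varieties*, Springer 1996, V.4.8.1.
* Z. Tian, H. R. Zong, *One-cycles on rationally connected varieties*, Compositio Math. 150 (2014),
  396–408, proof of Thm. 6.1. [TianZong2014]
* [Hartshorne1977] R. Hartshorne, *Algebraic Geometry*, I Ex. 2.11, II Ex. 2.14 (as used by
  `Motives/LinesInProjectiveSpace`, `Motives/ProjectiveSpaceFieldPoints`).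
-/

noncomputable section

open MvPolynomial AlgebraicGeometry CategoryTheory

universe u

namespace Literature.AlgebraicGeometry.Motives

variable {k : Type u} [Field k] {N : ℕ}

/-- Points of `ℙᴺ` with equal homogeneous coordinates are equal (proof-irrelevance helper).
[folklore] -/
theorem ProjectiveSpace.pt_pointOfVec_congr {L : Type u} [Field L] [Algebra k L]
    {u u' : Fin (N + 1) → L} (h : u = u') (hu : u ≠ 0) (hu' : u' ≠ 0) :
    (ProjectiveSpace.pointOfVec (n := N) k u hu).pt = (ProjectiveSpace.pointOfVec k u' hu').pt := by
  subst h; rfl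

/-- **A line of `X` through a span, with all its points.** For a closed `k`-immersion
`i : X ↪ ℙᴺ_k` with image `V₊(F)` and independent vectors `w₀, w₁` with every `Fₐ` vanishing on
`span(w₀, w₁)`, there is a line point `z` of `X` whose closure contains, for every non-zero
`u ∈ span(w₀, w₁)`, a point of `X` mapped to `[u]`. [folklore] -/
theorem exists_isLinePoint_forall_mem_span [Infinite k] {X : SchemeOver k}
    (i : X ⟶ projectiveSpace N k) [IsClosedImmersion i.left] (hN : 1 ≤ N) {ι : Type*}
    (F : ι → MvPolynomial (Fin (N + 1)) k)
    (hV : letI := MvPolynomial.gradedAlgebra (σ := Fin (N + 1)) (R := k)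
      Set.range i.left.base =
        ProjectiveSpectrum.zeroLocus (MvPolynomial.homogeneousSubmodule (Fin (N + 1)) k)
          (Set.range F))
    {w : Fin 2 → Fin (N + 1) → k} (hw : LinearIndependent k w)
    (hFw : ∀ a, ∀ u ∈ Submodule.span k (Set.range w), eval u (F a) = 0) :
    ∃ z : ↥X.left, IsLinePoint N i z ∧
      ∀ u (hu0 : u ≠ 0), u ∈ Submodule.span k (Set.range w) →
        ∃ x' ∈ closure ({z} : Set ↥X.left),
          i.left.base x' = (ProjectiveSpace.pointOfVec k u hu0).pt := by
  classical
  letI := MvPolynomial.gradedAlgebra (σ := Fin (N + 1)) (R := k)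
  -- the `N - 1` linear forms cutting out `span(w)`
  obtain ⟨t, L, htu, hL, hLhom, hFL, hLvan⟩ :=
    EsnaultLevineViehweg.exists_linearForms_forall_mem_ideal_span F hw hFw
  obtain rfl : t = N - 1 := by omega
  -- the line `V₊(L)` lies on `i(X) = V₊(F)`
  have hsub : ProjectiveSpectrum.zeroLocus (MvPolynomial.homogeneousSubmodule (Fin (N + 1)) k)
      (Set.range L) ⊆ Set.range i.left.base := by
    intro q hq
    have hqL := (ProjectiveSpectrum.mem_zeroLocus _ _ _).mp hq
    have hspan : Ideal.span (Set.range L) ≤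
        (ProjectiveSpectrum.asHomogeneousIdeal
          (𝒜 := (MvPolynomial.homogeneousSubmodule (Fin (N + 1)) k)) q).toIdeal :=
      Ideal.span_le.mpr hqL
    have hq' : (q : ↥(projectiveSpace N k).left) ∈
        ProjectiveSpectrum.zeroLocus (MvPolynomial.homogeneousSubmodule (Fin (N + 1)) k)
          (Set.range F) :=
      (ProjectiveSpectrum.mem_zeroLocus _ _ _).mpr (by
        rintro _ ⟨j, rfl⟩
        exact hspan (hFL j))
    have hq'' : (q : ↥(projectiveSpace N k).left) ∈ Set.range i.left.base := by
      rw [hV]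
      exact hq'
    exact hq''
  obtain ⟨z, hz, himg⟩ := exists_isLinePoint_of_zeroLocus_subset i hN L hL hLhom hsub
  refine ⟨z, hz, fun u hu0 hu => ?_⟩
  -- `[u] ∈ V₊(L) = i(closure {z})`
  have hpt : (ProjectiveSpace.pointOfVec k u hu0).pt ∈
      ProjectiveSpectrum.zeroLocus (MvPolynomial.homogeneousSubmodule (Fin (N + 1)) k)
        (Set.range L) := by
    refine (ProjectiveSpectrum.mem_zeroLocus _ _ _).mpr ?_
    rintro _ ⟨j, rfl⟩
    have hj : (ProjectiveSpace.pointOfVec k u hu0).pt ∈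
        ProjectiveSpectrum.zeroLocus (MvPolynomial.homogeneousSubmodule (Fin (N + 1)) k) {L j} := by
      refine (ProjectiveSpace.pt_pointOfVec_mem_zeroLocus_iff u hu0 one_pos
        ((mem_homogeneousSubmodule _ _).mpr (hLhom j))).mpr ?_
      rw [MvPolynomial.aeval_eq_eval]
      exact hLvan j u hu
    exact Set.singleton_subset_iff.mp ((ProjectiveSpectrum.mem_zeroLocus _ _ _).mp hj)
  rw [← himg] at hpt
  obtain ⟨x', hx', hxx'⟩ := hpt
  exact ⟨x', hx', hxx'⟩

/-- **Chain connectedness by lines of `X = V₊(F₁, …, F_c) ⊆ ℙᴺ_k`, `Σ deg Fₐ ≤ N - 1`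
(Kollár V.4.8.1, on the tree's schemes).** Let `k` be algebraically closed and `i : X ↪ ℙᴺ_k` a
closed `k`-immersion of a `k`-scheme locally of finite type whose image is the common zero locus
`V₊(F₁, …, F_c)` of forms of degrees `dₐ ≥ 1` with `Σₐ dₐ + 1 ≤ N`. Then any two closed points
`x, y` of `X` are joined by a connected chain of lines of `X`: line points `ℓ₀, …, ℓ_m`
(`IsLinePoint N i`) with `x ∈ closure {ℓ₀}`, `y ∈ closure {ℓ_m}` and consecutive closures
meeting. The chain in coordinates is
`Literature.RingTheory.MvPolynomial.exists_chain_of_sum_deg_le` (multihomogeneous Bézout);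
degenerate links are replaced by lines through the repeated point.
[cite: TianZong2014, proof of Thm. 6.1 (first sentence: Kollár V.4.8.1)] -/
theorem exists_lineChain_of_isClosed [IsAlgClosed k] {X : SchemeOver k} [LocallyOfFiniteType X.hom]
    (i : X ⟶ projectiveSpace N k) [IsClosedImmersion i.left] {c : ℕ}
    (F : Fin c → MvPolynomial (Fin (N + 1)) k) (d : Fin c → ℕ) (hF : ∀ a, (F a).IsHomogeneous (d a))
    (hd : ∀ a, 0 < d a) (hsum : ∑ a, d a + 1 ≤ N)
    (hV : letI := MvPolynomial.gradedAlgebra (σ := Fin (N + 1)) (R := k)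
      Set.range i.left.base =
        ProjectiveSpectrum.zeroLocus (MvPolynomial.homogeneousSubmodule (Fin (N + 1)) k)
          (Set.range F))
    {x y : ↥X.left} (hx : IsClosed ({x} : Set ↥X.left)) (hy : IsClosed ({y} : Set ↥X.left)) :
    ∃ (m : ℕ) (ℓ : Fin (m + 1) → ↥X.left), (∀ j, IsLinePoint N i (ℓ j)) ∧
      x ∈ closure ({ℓ 0} : Set ↥X.left) ∧ y ∈ closure ({ℓ (Fin.last m)} : Set ↥X.left) ∧
      ∀ j : Fin m, (closure ({ℓ j.castSucc} : Set ↥X.left) ∩ closure {ℓ j.succ}).Nonempty := by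
  classical
  letI := MvPolynomial.gradedAlgebra (σ := Fin (N + 1)) (R := k)
  have hN : 1 ≤ N := by omega
  -- homogeneous coordinates of `x` and `y`
  have hcoord : ∀ {x : ↥X.left}, IsClosed ({x} : Set ↥X.left) →
      ∃ (p : Fin (N + 1) → k) (hp : p ≠ 0),
        i.left.base x = (ProjectiveSpace.pointOfVec k p hp).pt ∧ ∀ a, eval p (F a) = 0 := by
    intro x hx
    obtain ⟨P, hPx⟩ := EsnaultLevineViehweg.exists_algPoints_pt_eq (X := X) hx
    obtain ⟨p, hp, hQ⟩ := ProjectiveSpace.exists_eq_pointOfVec (AlgPoints.map i P)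
    have hix : i.left.base x = (ProjectiveSpace.pointOfVec k p hp).pt := by
      rw [← hQ, AlgPoints.pt_map, hPx]
    refine ⟨p, hp, hix, fun a => ?_⟩
    have hmemV : (ProjectiveSpace.pointOfVec k p hp).pt ∈
        ProjectiveSpectrum.zeroLocus (MvPolynomial.homogeneousSubmodule (Fin (N + 1)) k)
          (Set.range F) := by
      rw [← hix, ← hV]
      exact ⟨x, rfl⟩
    have hj : (ProjectiveSpace.pointOfVec k p hp).pt ∈
        ProjectiveSpectrum.zeroLocus (MvPolynomial.homogeneousSubmodule (Fin (N + 1)) k) {F a} :=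
      (ProjectiveSpectrum.mem_zeroLocus _ _ _).mpr
        ((Set.singleton_subset_iff.mpr (Set.mem_range_self a : F a ∈ Set.range F)).trans
          ((ProjectiveSpectrum.mem_zeroLocus _ _ _).mp hmemV))
    have h := (ProjectiveSpace.pt_pointOfVec_mem_zeroLocus_iff p hp (hd a)
      ((mem_homogeneousSubmodule _ _).mpr (hF a))).mp hj
    rwa [MvPolynomial.aeval_eq_eval] at h
  obtain ⟨p, hp, hix, hFp⟩ := hcoord hx
  obtain ⟨q, hq, hiy, hFq⟩ := hcoord hy
  -- the chain in coordinates
  obtain ⟨r, v, hv0, hvr, hvne, hvF⟩ :=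
    Literature.RingTheory.MvPolynomial.exists_chain_of_sum_deg_le hF hd hsum p q hp hq hFp hFq
  have hFv : ∀ j ≤ r + 1, ∀ a, eval (v j) (F a) = 0 := by
    intro j hj a
    rcases Nat.lt_or_ge j (r + 1) with hlt | hge
    · have h := hvF j (by omega) a 1 0
      simpa using h
    · have : j = r + 1 := by omega
      rw [this, hvr]; exact hFq a
  -- every link lies on a genuine line of `X` (degenerate links: any line through the point)
  have hlink : ∀ j ≤ r, ∃ w : Fin 2 → Fin (N + 1) → k, LinearIndependent k w ∧
      (∀ a, ∀ u ∈ Submodule.span k (Set.range w), eval u (F a) = 0) ∧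
      v j ∈ Submodule.span k (Set.range w) ∧ v (j + 1) ∈ Submodule.span k (Set.range w) := by
    intro j hj
    by_cases hind : LinearIndependent k ![v j, v (j + 1)]
    · refine ⟨![v j, v (j + 1)], hind, fun a u hu => ?_,
        Submodule.subset_span ⟨0, rfl⟩, Submodule.subset_span ⟨1, rfl⟩⟩
      rw [FanoScheme.range_vecCons_pair, Submodule.mem_span_pair] at hu
      obtain ⟨s, t, rfl⟩ := hu
      exact hvF j hj a s t
    · -- `v (j+1)` is a multiple of `v j`
      have hvj : v j ≠ 0 := hvne j (by omega)
      have hvj1 : v (j + 1) ≠ 0 := hvne (j + 1) (by omega)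
      rw [LinearIndependent.pair_iff] at hind
      simp only [not_forall, not_and] at hind
      obtain ⟨s, t, hst, hst0⟩ := hind
      have ht : t ≠ 0 := by
        intro ht
        rw [ht, zero_smul, add_zero] at hst
        rcases smul_eq_zero.mp hst with hs | hs
        · exact hst0 hs ht
        · exact hvj hs
      have hmul : v (j + 1) = (-(s / t)) • v j := by
        have h1 : t • v (j + 1) = -(s • v j) := eq_neg_of_add_eq_zero_right hst
        have h2 : v (j + 1) = t⁻¹ • (t • v (j + 1)) := by
          rw [smul_smul, inv_mul_cancel₀ ht, one_smul]
        rw [h2, h1, smul_neg, smul_smul, neg_smul, div_eq_inv_mul]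
      obtain ⟨v', hpv', hFv'⟩ :=
        EsnaultLevineViehweg.exists_linearIndependent_lineRestrict_eq_zero F d hF hsum hvj
          (hFv j (by omega))
      refine ⟨![v j, v'], hpv', fun a u hu =>
        EsnaultLevineViehweg.eval_eq_zero_of_lineRestrict_eq_zero (hFv' a) hu,
        Submodule.subset_span ⟨0, rfl⟩, ?_⟩
      rw [hmul]
      exact Submodule.smul_mem _ _ (Submodule.subset_span ⟨0, rfl⟩)
  -- the lines
  have hlines : ∀ j : Fin (r + 1), ∃ z : ↥X.left, IsLinePoint N i z ∧
      (∃ x' ∈ closure ({z} : Set ↥X.left),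
        i.left.base x' = (ProjectiveSpace.pointOfVec k (v j) (hvne j (by omega))).pt) ∧
      (∃ x' ∈ closure ({z} : Set ↥X.left),
        i.left.base x' =
          (ProjectiveSpace.pointOfVec k (v (j + 1)) (hvne (j + 1) (by omega))).pt) := by
    intro j
    obtain ⟨w, hw, hFw, hvj, hvj1⟩ := hlink j (by omega)
    obtain ⟨z, hz, hmem⟩ := exists_isLinePoint_forall_mem_span i hN F hV hw hFw
    exact ⟨z, hz, hmem _ _ hvj, hmem _ _ hvj1⟩
  choose ℓ hℓ hℓleft hℓright using hlines
  refine ⟨r, ℓ, hℓ, ?_, ?_, fun j => ?_⟩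
  · obtain ⟨x', hx', hxx'⟩ := hℓleft 0
    have h0 : v ((0 : Fin (r + 1)) : ℕ) = p := by rw [Fin.val_zero, hv0]
    have : x' = x := i.left.isClosedEmbedding.injective (by
      rw [hxx', hix, ProjectiveSpace.pt_pointOfVec_congr h0])
    rwa [this] at hx'
  · obtain ⟨x', hx', hxx'⟩ := hℓright (Fin.last r)
    have hr : v ((Fin.last r : Fin (r + 1)) + 1) = q := by rw [Fin.val_last, hvr]
    have : x' = y := i.left.isClosedEmbedding.injective (by
      rw [hxx', hiy, ProjectiveSpace.pt_pointOfVec_congr hr])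
    rwa [this] at hx'
  · obtain ⟨x₁, hx₁, hxx₁⟩ := hℓright j.castSucc
    obtain ⟨x₂, hx₂, hxx₂⟩ := hℓleft j.succ
    have hj : v ((j.castSucc : Fin (r + 1)) + 1) = v (j.succ : Fin (r + 1)) := by
      rw [Fin.val_succ, Fin.val_castSucc]
    have : x₂ = x₁ := i.left.isClosedEmbedding.injective (by
      rw [hxx₁, hxx₂, ProjectiveSpace.pt_pointOfVec_congr hj.symm])
    refine ⟨x₁, hx₁, ?_⟩
    rw [← this]; exact hx₂

end Literature.AlgebraicGeometry.Motives

end
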